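import Summits.BirchSwinnertonDyer.BirchSwinnertonDyer.Theorems.PrintCf2SplitBadTwoLayerNormCharIdeal
import Mathlib.LinearAlgebra.Matrix.Determinant.Basic
import HarnessLib

/-!
# The layer norm at `p = 2`, index `2` (`Γ² ⊂ Γ`): `N(f)(ω_1) = f(T) · f(−2 − T)` in closed form

Cell `bsd-print-cf2`, EXTRA WIDTH seat `bsd-line-cf2-p1-w3` g6, planner brick **B10** (RULING (af)(3)),
file 2, for crux `PrintCf2.SplitBadTwoRankOneOfFacts` (stmt-BirchSwinnertonDyer-20368) — the index-`2`
instance `Λ(Γ²) ⊂ Λ(Γ)`, `Γ ≅ ℤ₂` (the habitat line's S2b⁺ `stub_habitatMainIdentity_firstLayer_two`: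
`M = K₀(√2)` is the first layer of `K₀^{cyc}`, `Γ_M = Γ²`, «`G((1+T)²−1) ≐ (H_A H_A')(0,T)·(H_A H_A')(0,−2−T)`»).
THEOREMS ONLY (no `def`, no named fact, no `sorry`); Theses-free; pure algebra of `Λ = ℤ₂⟦T⟧`;
`--supports` the crux as a helper. BSD is not proved by any of this; no summit statement is proved here.

`Λ_1 = ℤ₂⟦ω_1⟧`, `ω_1 = (1+T)² − 1 = T² + 2T` (X1 `layerHom 2 1 : T ↦ ω_1`); `Λ = Λ_1 ⊕ Λ_1·T`, so every
`f ∈ Λ` is `f = a(ω_1) + b(ω_1)·T` with unique `a, b ∈ Λ` (X1 `Layer.existsUnique_eq_sum_layerHom_mul_X_pow`,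
`coord`). The non-trivial `Λ_1`-automorphism of `Λ` is `1 + T ↦ −(1 + T)`, i.e. `T ↦ −2 − T` (it fixes
`ω_1`), under which `f ↦ f♭ := a(ω_1) − (2 + T)·b(ω_1)`.
* `layerNorm_two_one_of_coords`: **`N_1(a(ω_1) + b(ω_1)T) = a² − 2ab − S·b²`** (in the variable `S` of
  `Λ_1 ≅ ℤ₂⟦S⟧`, `S ↦ ω_1`) — X1 `layerNorm_eq_det` with the `2 × 2` matrix of multiplication by `f` in the
  basis `1, T` (`T² = ω_1 − 2T`);
* `layerHom_layerNorm_two_one_of_coords`: **`N_1(f)(ω_1) = f · f♭`**; `exists_coords_layerNorm_two_one`: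
  the same for an arbitrary `f`, with its coordinates.
With file 1 (`PrintCf2SplitBadTwoLayerNormCharIdeal`: `char_Λ Y = (N_1 f)` for `Y` = a finitely generated
torsion `Λ`-module `X`, `char_Λ X = (f)`, restricted to `Γ²`) this is the algebra of «restriction of scalars
`Λ → Λ_M`, norm of the characteristic ideal» in S2b⁺: `char_{Λ_M} = (G)`, `G(ω_1) = f(T)·f(−2−T)`.

References: L. C. Washington, *Introduction to Cyclotomic Fields*, GTM 83, §13.2 [Washington1997];
N. Bourbaki, *Algèbre* III §9 (norm = determinant of multiplication) [BourbakiAC5to7].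
-/

noncomputable section

set_option linter.dupNamespace false -- D-0017: single-problem summit, `…BirchSwinnertonDyer.BirchSwinnertonDyer…` repeats a namespace by design

namespace Summit.BirchSwinnertonDyer.BirchSwinnertonDyer.Theorems.PrintCf2.LayerNormCharIdeal

open PowerSeries Literature.NumberTheory.EllipticCurves
  Summit.BirchSwinnertonDyer.Rank1Residual.X1.LayerAlgebra

universe v w

/-- `T² = ω_1 − 2T` in `ℤ₂⟦T⟧` (`ω_1 = (1+T)² − 1`). [folklore] -/
theorem X_sq_eq_omega_sub : (X : IwasawaAlgebra 2) ^ 2 = ((1 + X) ^ 2 ^ 1 - 1) - 2 * X := by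
  ring

/-- **`N_1(a(ω_1) + b(ω_1)·T) = a² − 2ab − S·b²`** at `p = 2`: the norm of the rank-`2` free extension
`Λ ⊃ Λ_1 = ℤ₂⟦ω_1⟧`, by the multiplication table of `f = a(ω_1) + b(ω_1)T` in the basis `1, T`
(`f·1 = a(ω_1) + b(ω_1)T`, `f·T = (S b)(ω_1) + (a − 2b)(ω_1)T` using `T² = ω_1 − 2T`) and a `2 × 2`
determinant (X1 `layerNorm_eq_det`). [cite: Washington1997, §13.2] -/
theorem layerNorm_two_one_of_coords (a b : IwasawaAlgebra 2) :
    layerNorm 2 1 (layerHom 2 1 a + layerHom 2 1 b * X) = a ^ 2 - 2 * a * b - X * b ^ 2 := by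
  let Q : Matrix (Fin 2) (Fin 2) (IwasawaAlgebra 2) := Matrix.of ![![a, b], ![X * b, a - 2 * b]]
  have hQ : ∀ j : Fin 2, (layerHom 2 1 a + layerHom 2 1 b * X) * X ^ (j : ℕ) =
      ∑ i : Fin 2, layerHom 2 1 (Q j i) * X ^ (i : ℕ) := by
    intro j
    fin_cases j
    · simp [Q, Fin.sum_univ_two]
    · simp [Q, Fin.sum_univ_two, layerHom_X, map_mul, map_sub, map_ofNat]
      ring
  rw [layerNorm_eq_det 2 1 Q hQ, Matrix.det_fin_two]
  simp only [Q, Matrix.of_apply, Matrix.cons_val_zero, Matrix.cons_val_one]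
  ring

/-- **`N_1(f)(ω_1) = f(T) · f(−2 − T)`** in coordinates: for `f = a(ω_1) + b(ω_1)T`,
`N_1(f)(ω_1) = f · f♭` with `f♭ = a(ω_1) − (2 + T)·b(ω_1)` — the image of `f` under the `Λ_1`-automorphism
`T ↦ −2 − T` of `Λ` (`ω_1 ↦ ω_1`). [cite: Washington1997, §13.2] -/
theorem layerHom_layerNorm_two_one_of_coords (a b : IwasawaAlgebra 2) :
    layerHom 2 1 (layerNorm 2 1 (layerHom 2 1 a + layerHom 2 1 b * X)) =
      (layerHom 2 1 a + layerHom 2 1 b * X) * (layerHom 2 1 a - (2 + X) * layerHom 2 1 b) := by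
  rw [layerNorm_two_one_of_coords]
  simp only [map_sub, map_mul, map_pow, map_ofNat, layerHom_X]
  ring

/-- **Coordinates**: every `f ∈ Λ = ℤ₂⟦T⟧` is `a(ω_1) + b(ω_1)·T` (`a, b` = X1's `coord 2 1 f`).
[cite: Washington1997, §13.2] -/
theorem eq_coords_two_one (f : IwasawaAlgebra 2) :
    f = layerHom 2 1 (coord 2 1 f 0) + layerHom 2 1 (coord 2 1 f 1) * X := by
  conv_lhs => rw [← sum_layerHom_coord_mul_X_pow (p := 2) (n := 1) f]
  rw [show (Finset.univ : Finset (Fin (2 ^ 1))) = {0, 1} from rfl, Finset.sum_pair (by decide)]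
  simp

/-- The coordinates are unique. [cite: Washington1997, §13.2] -/
theorem coords_two_one_unique {f a b : IwasawaAlgebra 2} (h : f = layerHom 2 1 a + layerHom 2 1 b * X) :
    a = coord 2 1 f 0 ∧ b = coord 2 1 f 1 := by
  have hu := (Layer.existsUnique_eq_sum_layerHom_mul_X_pow 2 1 f).unique
    (y₁ := ![a, b]) (y₂ := coord 2 1 f) ?_ ?_
  · exact ⟨(congr_fun hu 0 :), (congr_fun hu 1 :)⟩
  · rw [h, show (Finset.univ : Finset (Fin (2 ^ 1))) = {0, 1} from rfl, Finset.sum_pair (by decide)]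
    simp
  · exact (sum_layerHom_coord_mul_X_pow f).symm

/-- **`N_1(f)(ω_1) = f · f♭` for every `f ∈ ℤ₂⟦T⟧`**, with its coordinates `f = a(ω_1) + b(ω_1)T`,
`N_1 f = a² − 2ab − S b²`, `f♭ = a(ω_1) − (2+T) b(ω_1)` (`= f(−2−T)`). [cite: Washington1997, §13.2] -/
theorem exists_coords_layerNorm_two_one (f : IwasawaAlgebra 2) :
    ∃ a b : IwasawaAlgebra 2, f = layerHom 2 1 a + layerHom 2 1 b * X ∧
      layerNorm 2 1 f = a ^ 2 - 2 * a * b - X * b ^ 2 ∧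
      layerHom 2 1 (layerNorm 2 1 f) = f * (layerHom 2 1 a - (2 + X) * layerHom 2 1 b) := by
  refine ⟨coord 2 1 f 0, coord 2 1 f 1, eq_coords_two_one f, ?_, ?_⟩
  · conv_lhs => rw [eq_coords_two_one f]
    exact layerNorm_two_one_of_coords _ _
  · conv_lhs => rw [eq_coords_two_one f]
    rw [layerHom_layerNorm_two_one_of_coords, ← eq_coords_two_one f]

/-- **B10 at `p = 2`, index `2` — the S2b⁺ currency.** Let `V` be a finitely generated torsion
`Λ = ℤ₂⟦T⟧`-module with `char_Λ V = (f)` and `Y` any `Λ`-module with a bijective `layerHom 2 1`-semilinear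
`ψ : Y → V` (`Y` = `V` with only `Γ²` acting, in the variable of `Λ_1 = ℤ₂⟦ω_1⟧ ≅ Λ` — e.g. the dual Selmer
group of a curve over `K₀^{cyc}` read over the first layer `M = K₀(√2)`). Then for EVERY ring map
`J : ℤ₂ → 𝒪` (e.g. into `𝒪_{ℂ₂}`), in coordinates `f = a(ω_1) + b(ω_1)T`:
`(char_Λ Y)·𝒪⟦S⟧ = (G)` with `G = (a² − 2ab − S b²).map J` and
**`G((1 + T)² − 1) = f.map J · f♭.map J`**, `f♭ = a(ω_1) − (2+T) b(ω_1) = f(−2−T)` — the shape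
«`D.charIdeal.map (PowerSeries.map J) = Ideal.span {G}` ∧ `G.subst ((1+X)^2 − 1) = …`» of
`stub_habitatMainIdentity_firstLayer_two`. [cite: Washington1997, §13.2] [cite: BourbakiAC5to7, Ch. VII §4 no. 5] -/
theorem charIdeal_map_eq_span_firstLayer_two {V : Type v} [AddCommGroup V] [Module (IwasawaAlgebra 2) V]
    [Module.Finite (IwasawaAlgebra 2) V] (hV : Module.IsTorsion (IwasawaAlgebra 2) V)
    {Y : Type w} [AddCommGroup Y] [Module (IwasawaAlgebra 2) Y]
    (ψ : Y →ₛₗ[layerHom 2 1] V) (hψ : Function.Bijective ψ) {f : IwasawaAlgebra 2}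
    (hf : Module.charIdeal (IwasawaAlgebra 2) V = Ideal.span {f}) {𝒪 : Type*} [CommRing 𝒪]
    (J : ℤ_[2] →+* 𝒪) :
    ∃ a b : IwasawaAlgebra 2, f = layerHom 2 1 a + layerHom 2 1 b * X ∧
      (Module.charIdeal (IwasawaAlgebra 2) Y).map (PowerSeries.map J) =
          Ideal.span {PowerSeries.map J (a ^ 2 - 2 * a * b - X * b ^ 2)} ∧
        (PowerSeries.map J (a ^ 2 - 2 * a * b - X * b ^ 2)).subst ((1 + X : PowerSeries 𝒪) ^ 2 - 1) =
          PowerSeries.map J f * PowerSeries.map J (layerHom 2 1 a - (2 + X) * layerHom 2 1 b) := by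
  obtain ⟨a, b, hfab, hN, hLN⟩ := exists_coords_layerNorm_two_one f
  obtain ⟨h1, h2⟩ := charIdeal_map_eq_span_of_semilinear hV ψ hψ hf J
  refine ⟨a, b, hfab, by rw [h1, hN], ?_⟩
  rw [pow_one] at h2
  rw [← hN, h2, hLN, map_mul]

end Summit.BirchSwinnertonDyer.BirchSwinnertonDyer.Theorems.PrintCf2.LayerNormCharIdeal

end
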